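import Literature.Topology.FourManifolds.SmoothOrientationDiffeomorphProofs
import HarnessLib

/-!
# The orientation character of a local diffeomorphism is locally constant

Topic `Literature/Topology/FourManifolds`; general differential topology written for the fact
seat `provefact-Literature.Topology.FourManifolds.nonempty_diffeomorph_sphere_four_of_sblf_genus_one_noLefschetz`
(torus assembly step: orientation characters of boundary maps of cylinders have to be read off
end by end through local parametrisations).  Everything here is **proved**; no named facts and no
new definitions.

## Mathematics

Let `f : M → N` be a `Cⁿ` map (`n ≠ 0`) between manifolds modelled on the same vector space `E`
and oriented by `oM`, `oN` (`Literature.Topology.FourManifolds.SmoothOrientation`), whose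
differential `mfderiv f x` (in the preferred charts) has nonzero Jacobian determinant at every
point — a local diffeomorphism.  The **orientation character of `f` at `x`** is the statement
"`oN (f x) = oM x` iff `det (mfderiv f x) > 0`" (so that `IsOrientationPreserving oM oN f` is
"the character holds at every point", `SmoothOrientation.lean`).  As for diffeomorphisms
(`Diffeomorph.eventually_isOrientationPreservingAt_iff`, `SmoothOrientationDiffeomorphProofs.lean`,
whose proof uses only `Cⁿ`-regularity, continuity and the non-vanishing of the Jacobian, and is
repeated here verbatim):

* `eventually_isOrientationPreservingAt_iff_of_det_ne_zero` — the character is **locally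
  constant** (Hirsch, *Differential Topology* (1976), Ch. 4 §4, p. 101: the sign of the Jacobian
  in fixed charts is locally constant, and passing to the preferred charts changes orientations
  and Jacobians consistently);
* `isOrientationPreservingAt_iff_of_isPreconnected` — hence **constant along every preconnected
  set** (so a local diffeomorphism out of a connected manifold preserves or reverses the
  orientations; Hirsch, loc. cit., "when `M` is connected `f` must have one of these properties");
* `isOrientationPreservingAt_comp_iff` — the **pointwise chain rule for characters**: at `x`, the
  character of `g ∘ f` holds iff the characters of `g` at `f x` and of `f` at `x` have the same
  truth value (`mfderiv_comp`, `LinearMap.det_comp`; the pointwise content of the tree's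
  `IsOrientationPreserving.comp_holds`).

## References

* M. W. Hirsch, *Differential Topology*, GTM 33, Springer (1976), Ch. 4 §4, pp. 100–103.
  [HirschDT1976]
* J. M. Lee, *Introduction to Smooth Manifolds*, 2nd ed., GTM 218 (2013), Prop. 15.5,
  Exercise 15-7 (local diffeomorphisms and pullback orientations). [LeeSmoothManifolds2013]
-/

open scoped Manifold ContDiff Topology
open Set Module Filter

noncomputable section

namespace Literature.Topology.FourManifolds

section LocalConstancy

variable {E H H' : Type*} [NormedAddCommGroup E] [NormedSpace ℝ E] [TopologicalSpace H]
  [TopologicalSpace H'] {I : ModelWithCorners ℝ E H} {I' : ModelWithCorners ℝ E H'}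
  {M : Type*} [TopologicalSpace M] [ChartedSpace H M] [IsManifold I 1 M]
  {N : Type*} [TopologicalSpace N] [ChartedSpace H' N] [IsManifold I' 1 N] {n : WithTop ℕ∞}

/-- **Local constancy of the orientation character of a local diffeomorphism.** For a `Cⁿ` map
`f : M → N` (`n ≠ 0`, same model vector space) with nowhere-vanishing Jacobian determinant and
smooth orientations `oM`, `oN`, the statement "`oN (f y) = oM y ↔ det (mfderiv f y) > 0`" has,
for `y` near `x`, the truth value it has at `x`.  Proof as for
`Diffeomorph.eventually_isOrientationPreservingAt_iff`: the Jacobian of `f` in the *fixed* charts at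
`x`, `f x` depends continuously on the base point (`ContMDiffAt.mfderiv_const`), and the passage
to the preferred charts at `y`, `f y` changes `oM`, `oN ∘ f` and the Jacobian consistently.
Hirsch, *Differential Topology* (1976), Ch. 4 §4, p. 101. [cite: HirschDT1976, §4.4 p. 101] -/
theorem eventually_isOrientationPreservingAt_iff_of_det_ne_zero {f : M → N}
    (hf : ContMDiff I I' n f) (hn : n ≠ 0)
    (hd : ∀ x, LinearMap.det (M := E) (mfderiv I I' f x).toLinearMap ≠ 0)
    (oM : SmoothOrientation I M) (oN : SmoothOrientation I' N) (x : M) :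
    ∀ᶠ y in 𝓝 x,
      ((oN (f y) = oM y ↔ 0 < LinearMap.det (M := E) (mfderiv I I' f y).toLinearMap) ↔
        (oN (f x) = oM x ↔ 0 < LinearMap.det (M := E) (mfderiv I I' f x).toLinearMap)) := by
  have hfc : ContinuousAt f x := hf.continuous.continuousAt
  -- `df` in the preferred charts, its determinant is nowhere zero
  set df : M → E →L[ℝ] E := fun y => (mfderiv I I' f y : E →L[ℝ] E) with hdf
  have hd0 : ∀ y, LinearMap.det (M := E) (df y : E →ₗ[ℝ] E) ≠ 0 := hd
  -- local constancy of the two orientations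
  have h1 := oM.eventually_eq_iff x
  have h2 := hfc.eventually (oN.eventually_eq_iff (f x))
  -- chart domains
  have h3 : ∀ᶠ y in 𝓝 x, y ∈ (extChartAt I x).source := extChartAt_source_mem_nhds x
  have h3' : ∀ᶠ y in 𝓝 x, f y ∈ (extChartAt I' (f x)).source :=
    hfc.eventually (extChartAt_source_mem_nhds (f x))
  -- `df` read in the fixed charts at `x`, `f x`, as a function of the base point
  set G : M → E →L[ℝ] E := inTangentCoordinates I I' id f df x with hG_def
  have hG : ContinuousAt G x := by
    have h := ((hf x).mfderiv_const (m := 0)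
      (by simpa only [zero_add] using (ENat.one_le_iff_ne_zero_withTop.mpr hn)))
    exact h.continuousAt
  have hGdet : ContinuousAt (fun y => LinearMap.det (M := E) (G y : E →ₗ[ℝ] E)) x :=
    (ContinuousLinearMap.continuous_det.continuousAt).comp hG
  -- the formula for `G` on the common chart domain
  have hGeq : ∀ y, y ∈ (extChartAt I x).source → f y ∈ (extChartAt I' (f x)).source →
      G y = (tangentCoordChange I' (f y) (f x) (f y)).comp
        ((df y).comp (tangentCoordChange I x y y)) := by
    intro y hy hy'
    rw [extChartAt_source] at hy hy'
    exact inTangentCoordinates_eq id f df (x₀ := x) (x := y) hy hy'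
  have hGx : LinearMap.det (M := E) (G x : E →ₗ[ℝ] E) =
      LinearMap.det (M := E) (df x).toLinearMap := by
    have hx := mem_extChartAt_source (I := I) x
    have hx' := mem_extChartAt_source (I := I') (f x)
    rw [hGeq x hx hx', det_comp_comp, det_tangentCoordChange_self hx,
      det_tangentCoordChange_self hx', one_mul, mul_one]
  -- hence the sign of `det G` near `x` is the sign of `det df_x`
  have h4 : ∀ᶠ y in 𝓝 x, (0 < LinearMap.det (M := E) (G y : E →ₗ[ℝ] E) ↔
      0 < LinearMap.det (M := E) (df x).toLinearMap) := by
    rw [← hGx]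
    have hGx0 : LinearMap.det (M := E) (G x : E →ₗ[ℝ] E) ≠ 0 := hGx ▸ hd0 x
    rcases lt_or_gt_of_ne hGx0 with h | h
    · filter_upwards [hGdet.eventually (gt_mem_nhds h)] with y hy
      exact iff_of_false (lt_asymm hy) (lt_asymm h)
    · filter_upwards [hGdet.eventually (lt_mem_nhds h)] with y hy
      exact iff_of_true hy h
  filter_upwards [h1, h2, h3, h3', h4] with y hA hB hy hy' hD
  have hyM := mem_extChartAt_source (I := I) y
  have hyN := mem_extChartAt_source (I := I') (f y)
  have pM := det_tangentCoordChange_mul_det_tangentCoordChange hy hyM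
  have pN := det_tangentCoordChange_mul_det_tangentCoordChange hy' hyN
  have hp0 := right_ne_zero_of_mul_eq_one pM
  have hp'0 := left_ne_zero_of_mul_eq_one pM
  have hq0 := right_ne_zero_of_mul_eq_one pN
  have hP := (mul_pos_iff_pos_iff_pos hp'0 hp0).mp (pM ▸ one_pos)
  rw [hGeq y hy hy', det_comp_comp, mul_pos_iff_pos_iff_pos hq0 (mul_ne_zero (hd0 y) hp'0),
    mul_pos_iff_pos_iff_pos (hd0 y) hp'0] at hD
  exact isOrientationPreservingAt_bookkeeping (orientation_eq_iff_eq_iff_eq _ (oN (f x)) _)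
    (orientation_eq_iff_eq_iff_eq _ (oM x) _) (eq_comm.trans hA) hB hP hD

/-- **The orientation character of a local diffeomorphism is constant along preconnected
sets.** Under the hypotheses of `eventually_isOrientationPreservingAt_iff_of_det_ne_zero`, the set
of points where the character holds is open and closed, so on a preconnected set `A` the
character has the same truth value at any two points (Hirsch, *Differential Topology* (1976),
Ch. 4 §4, p. 101: "when `M` is connected, `f` must [preserve or reverse orientation]").
[cite: HirschDT1976, §4.4 p. 101] -/
theorem isOrientationPreservingAt_iff_of_isPreconnected {f : M → N}
    (hf : ContMDiff I I' n f) (hn : n ≠ 0)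
    (hd : ∀ x, LinearMap.det (M := E) (mfderiv I I' f x).toLinearMap ≠ 0)
    (oM : SmoothOrientation I M) (oN : SmoothOrientation I' N) {A : Set M}
    (hA : IsPreconnected A) {x y : M} (hx : x ∈ A) (hy : y ∈ A) :
    (oN (f x) = oM x ↔ 0 < LinearMap.det (M := E) (mfderiv I I' f x).toLinearMap) ↔
      (oN (f y) = oM y ↔ 0 < LinearMap.det (M := E) (mfderiv I I' f y).toLinearMap) := by
  set S : Set M := {z | oN (f z) = oM z ↔
    0 < LinearMap.det (M := E) (mfderiv I I' f z).toLinearMap} with hS_def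
  have hev := eventually_isOrientationPreservingAt_iff_of_det_ne_zero hf hn hd oM oN
  have hS : IsClopen S := by
    constructor
    · rw [← isOpen_compl_iff, isOpen_iff_mem_nhds]
      intro z hz
      filter_upwards [hev z] with w hw
      exact fun h => hz (hw.mp h)
    · rw [isOpen_iff_mem_nhds]
      intro z hz
      filter_upwards [hev z] with w hw
      exact hw.mpr hz
  by_cases hxS : x ∈ S
  · have hsub : A ⊆ S := hA.subset_isClopen hS ⟨x, hx, hxS⟩
    exact iff_of_true hxS (hsub hy)
  · have hsub : A ⊆ Sᶜ := hA.subset_isClopen hS.compl ⟨x, hx, hxS⟩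
    exact iff_of_false hxS (hsub hy)

/-- **A local diffeomorphism out of a connected manifold preserves or reverses the
orientations** (the version of `Diffeomorph.isOrientationPreserving_or_isOrientationReversing` for
`Cⁿ` maps with nowhere-vanishing Jacobian; Hirsch (1976), Ch. 4 §4, p. 101).
[cite: HirschDT1976, §4.4 p. 101] -/
theorem isOrientationPreserving_or_isOrientationReversing_of_det_ne_zero [ConnectedSpace M]
    {f : M → N} (hf : ContMDiff I I' n f) (hn : n ≠ 0)
    (hd : ∀ x, LinearMap.det (M := E) (mfderiv I I' f x).toLinearMap ≠ 0)
    (oM : SmoothOrientation I M) (oN : SmoothOrientation I' N) :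
    IsOrientationPreserving oM oN f ∨ IsOrientationReversing oM oN f := by
  by_cases h : ∀ x, (oN (f x) = oM x ↔ 0 < LinearMap.det (M := E) (mfderiv I I' f x).toLinearMap)
  · exact Or.inl h
  · right
    obtain ⟨x₀, hx₀⟩ := not_forall.mp h
    intro x
    have hx : ¬ (oN (f x) = oM x ↔
        0 < LinearMap.det (M := E) (mfderiv I I' f x).toLinearMap) := fun hx =>
      hx₀ ((isOrientationPreservingAt_iff_of_isPreconnected hf hn hd oM oN
        isPreconnected_univ (mem_univ x) (mem_univ x₀)).mp hx)
    show (-oN) (f x) = oM x ↔ 0 < LinearMap.det (M := E) (mfderiv I I' f x).toLinearMap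
    rw [SmoothOrientation.neg_apply]
    rcases orientation_eq_or_eq_neg (oM x) (oN (f x)) with h1 | h1
    · rw [h1] at hx ⊢
      exact iff_of_false (Module.Ray.ne_neg_self _).symm fun hpos => hx (iff_of_true rfl hpos)
    · rw [h1] at hx ⊢
      refine iff_of_true rfl ?_
      by_contra hneg
      exact hx (iff_of_false (Module.Ray.ne_neg_self _) hneg)

end LocalConstancy

/-! ### The pointwise chain rule for orientation characters -/

section Comp

variable {E : Type*} [NormedAddCommGroup E] [NormedSpace ℝ E]
  {H₁ H₂ H₃ : Type*} [TopologicalSpace H₁] [TopologicalSpace H₂] [TopologicalSpace H₃]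
  {I₁ : ModelWithCorners ℝ E H₁} {I₂ : ModelWithCorners ℝ E H₂} {I₃ : ModelWithCorners ℝ E H₃}
  {M₁ : Type*} [TopologicalSpace M₁] [ChartedSpace H₁ M₁] [IsManifold I₁ 1 M₁]
  {M₂ : Type*} [TopologicalSpace M₂] [ChartedSpace H₂ M₂] [IsManifold I₂ 1 M₂]
  {M₃ : Type*} [TopologicalSpace M₃] [ChartedSpace H₃ M₃] [IsManifold I₃ 1 M₃]

/-- Parity bookkeeping for three orientations and two Jacobians. [folklore] -/
theorem comp_character_bookkeeping {U V W : Prop} {a b : ℝ} (hUW : U ↔ (V ↔ W)) (ha : a ≠ 0)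
    (hb : b ≠ 0) : (U ↔ 0 < a * b) ↔ ((V ↔ 0 < a) ↔ (W ↔ 0 < b)) := by
  rw [mul_pos_iff_pos_iff_pos ha hb, hUW]
  tauto

/-- **Pointwise chain rule for orientation characters.** Let `f : M₁ → M₂`, `g : M₂ → M₃` be
differentiable at `x`, `f x` with invertible differentials (all manifolds modelled on the same
vector space and oriented by `o₁`, `o₂`, `o₃`). Then the character of `g ∘ f` at `x`
("`o₃ (g (f x)) = o₁ x ↔ det (d(g ∘ f)ₓ) > 0`") holds iff the characters of `g` at `f x` and of
`f` at `x` have the same truth value: `d(g ∘ f)ₓ = dg_{f x} ∘ dfₓ` and a fibre has exactly two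
orientations (Hirsch, *Differential Topology* (1976), Ch. 4 §4). [cite: HirschDT1976, §4.4] -/
theorem isOrientationPreservingAt_comp_iff (o₁ : SmoothOrientation I₁ M₁)
    (o₂ : SmoothOrientation I₂ M₂) (o₃ : SmoothOrientation I₃ M₃) {g : M₂ → M₃} {f : M₁ → M₂}
    {x : M₁} (hg : MDifferentiableAt I₂ I₃ g (f x)) (hf : MDifferentiableAt I₁ I₂ f x)
    (hg' : LinearMap.det (M := E) (mfderiv I₂ I₃ g (f x)).toLinearMap ≠ 0)
    (hf' : LinearMap.det (M := E) (mfderiv I₁ I₂ f x).toLinearMap ≠ 0) :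
    (o₃ (g (f x)) = o₁ x ↔ 0 < LinearMap.det (M := E) (mfderiv I₁ I₃ (g ∘ f) x).toLinearMap) ↔
      ((o₃ (g (f x)) = o₂ (f x) ↔ 0 < LinearMap.det (M := E) (mfderiv I₂ I₃ g (f x)).toLinearMap) ↔
        (o₂ (f x) = o₁ x ↔ 0 < LinearMap.det (M := E) (mfderiv I₁ I₂ f x).toLinearMap)) := by
  have hchain : mfderiv I₁ I₃ (g ∘ f) x = (mfderiv I₂ I₃ g (f x)).comp (mfderiv I₁ I₂ f x) :=
    mfderiv_comp x hg hf
  have hdet : LinearMap.det (M := E) (mfderiv I₁ I₃ (g ∘ f) x).toLinearMap =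
      LinearMap.det (M := E) (mfderiv I₂ I₃ g (f x)).toLinearMap *
        LinearMap.det (M := E) (mfderiv I₁ I₂ f x).toLinearMap := by
    rw [hchain]
    exact LinearMap.det_comp (M := E) (mfderiv I₂ I₃ g (f x)).toLinearMap
      (mfderiv I₁ I₂ f x).toLinearMap
  rw [hdet]
  exact comp_character_bookkeeping (orientation_eq_iff_eq_iff_eq _ (o₂ (f x)) _) hg' hf'

end Comp

end Literature.Topology.FourManifolds
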